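import Literature.AlgebraicGeometry.Motives.HodgeStructurePolarizationNormalSemisimple
import HarnessLib

/-!
# A commuting, adjoint-stable family of Hodge endomorphisms generates an algebra of semisimple endomorphisms

Sequel of `HodgeStructurePolarizationNormalSemisimple` (`Polarization.isSemisimple_of_mem`: a COMMUTATIVE subalgebra
`S ⊆ End_Hdg(V)` of Hodge endomorphisms of a polarised `ℚ`-Hodge structure that is stable under `ψ`-adjoints consists of
semisimple endomorphisms — positivity of the Rosati involution) in FAMILY form, the shape in which Hecke algebras are
given: a family `T : ι → End_ℚ V` of pairwise COMMUTING Hodge endomorphisms each of which has a `ψ`-adjoint INSIDE the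
algebra `ℚ[T i : i]` it generates («the family is closed under the transpose / Rosati involution»).

* `Polarization.exists_isAdjointPair_of_mem_adjoin` — adjoints propagate through `Algebra.adjoin`: every element of
  `ℚ[T i : i]` has a `ψ`-adjoint in `ℚ[T i : i]` (sum ↦ sum, product ↦ reversed product, scalar ↦ scalar).
* `Polarization.isSemisimple_of_mem_adjoin` — **every element of `ℚ[T i : i]` is a semisimple endomorphism of `V`**
  (`ℚ[T i : i]` is commutative by `Algebra.commute_of_mem_adjoin_of_forall_mem_commute`, consists of Hodge
  endomorphisms, and is adjoint-stable; apply `Polarization.isSemisimple_of_mem`).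

This is the input shape `hss : ∀ a ∈ ℚ[T_k], a.IsSemisimple` of the CM-type criteria
`HodgeTheory/CMTypeOfSemisimpleRationalAction(Family)`; for the Hecke operators `T_γ` on `H¹` of a compact Shimura
surface the adjoint of `T_γ` is `T_{γ⁻¹}` (Shimura 1971, §3.4 (3.4.5)), so an inverse-closed commuting family of them
qualifies.  Cell pub-hodgecm2, lane «L-BYPASS» (kernel text by the seat pub-hodgecm2-s2crux-idea-2, probe `RA-v32` Part J,
gen 8; filed by b10).  Theorems only; no named fact.

References: H. Lange, *Abelian Varieties over the Complex Numbers* (2023), §2.4.1 Thm. 2.4.9 and §2.4.3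
[Lange2023AbelianVarietiesC]; D. Mumford, *Abelian Varieties* (1970), §21 (positivity of the Rosati involution)
[MumfordAV1970]; G. Shimura, *Introduction to the Arithmetic Theory of Automorphic Functions* (1971), §3.2–3.4, §7.2–7.3
[Shimura1971].
-/

noncomputable section

namespace Literature.AlgebraicGeometry.Motives

namespace HodgeStructure

universe u

variable {V : Type u} [AddCommGroup V] [Module ℚ V] {n : ℤ} {H : HodgeStructure V n}

/-- **Adjoints propagate through the generated algebra.**  If every generator `T i` has a `ψ`-adjoint inside
`ℚ[T i : i]`, then so does every element of `ℚ[T i : i]` (the adjoint of a sum is the sum, of a product the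
reversed product, of a scalar the scalar). [cite: Lange2023AbelianVarietiesC, §2.4.1 Thm. 2.4.9] -/
theorem Polarization.exists_isAdjointPair_of_mem_adjoin (ψ : Polarization H) {ι : Type*}
    (T : ι → Module.End ℚ V)
    (hadj : ∀ i, ∃ b ∈ Algebra.adjoin ℚ (Set.range T), LinearMap.IsAdjointPair ψ.form ψ.form (T i) b)
    {a : Module.End ℚ V} (ha : a ∈ Algebra.adjoin ℚ (Set.range T)) :
    ∃ b ∈ Algebra.adjoin ℚ (Set.range T), LinearMap.IsAdjointPair ψ.form ψ.form a b := by
  induction ha using Algebra.adjoin_induction with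
  | mem x hx =>
    obtain ⟨i, rfl⟩ := hx
    exact hadj i
  | algebraMap r =>
    refine ⟨algebraMap ℚ _ r, Subalgebra.algebraMap_mem _ r, fun x y => ?_⟩
    simp only [Module.algebraMap_end_apply, map_smul, LinearMap.smul_apply]
  | add x y _ _ ihx ihy =>
    obtain ⟨b, hb, hxb⟩ := ihx
    obtain ⟨d, hd, hyd⟩ := ihy
    exact ⟨b + d, add_mem hb hd, hxb.add hyd⟩
  | mul x y _ _ ihx ihy =>
    obtain ⟨b, hb, hxb⟩ := ihx
    obtain ⟨d, hd, hyd⟩ := ihy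
    exact ⟨d * b, mul_mem hd hb, hxb.mul hyd⟩

/-- **The family door.**  Let `T i ∈ End_Hdg(V)` (`i ∈ ι`, `V` finite-dimensional, `ψ` a polarization) be
pairwise COMMUTING Hodge endomorphisms such that each `T i` has a `ψ`-adjoint inside the algebra `ℚ[T i : i]`
they generate («the family is closed under the Rosati∕transpose involution»).  Then EVERY element of
`ℚ[T i : i]` is a semisimple endomorphism of `V` — the algebra is commutative (`Algebra.commute_of_mem_adjoin_…`),
consists of Hodge endomorphisms and is `ψ`-adjoint-stable (`exists_isAdjointPair_of_mem_adjoin`), so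
`Polarization.isSemisimple_of_mem` applies.  This is the shape in which Hecke algebras enter
`isOfCMType_of_forall_eigensystem_oneType_of_isSemisimple` (`hss : ∀ a, (act a).IsSemisimple`).
[cite: Lange2023AbelianVarietiesC, §2.4.1 Thm. 2.4.9 and §2.4.3] [cite: MumfordAV1970, §21]
[cite: Shimura1971, §3.2–3.4 and §7.2–7.3] -/
theorem Polarization.isSemisimple_of_mem_adjoin [Module.Finite ℚ V] (ψ : Polarization H) {ι : Type*}
    (T : ι → Module.End ℚ V) (hT : ∀ i, T i ∈ H.endAlg) (hcomm : ∀ i j, Commute (T i) (T j))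
    (hadj : ∀ i, ∃ b ∈ Algebra.adjoin ℚ (Set.range T), LinearMap.IsAdjointPair ψ.form ψ.form (T i) b)
    {a : Module.End ℚ V} (ha : a ∈ Algebra.adjoin ℚ (Set.range T)) : a.IsSemisimple := by
  refine ψ.isSemisimple_of_mem (S := Algebra.adjoin ℚ (Set.range T)) (Algebra.adjoin_le ?_) ?_
    (fun b hb => ψ.exists_isAdjointPair_of_mem_adjoin T hadj hb) ha
  · rintro _ ⟨i, rfl⟩
    exact hT i
  · intro b hb d hd
    refine (Algebra.commute_of_mem_adjoin_of_forall_mem_commute hd fun y hy => ?_).eq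
    refine (Algebra.commute_of_mem_adjoin_of_forall_mem_commute hb fun x hx => ?_).symm
    obtain ⟨i, rfl⟩ := hx
    obtain ⟨j, rfl⟩ := hy
    exact hcomm j i

end HodgeStructure

end Literature.AlgebraicGeometry.Motives

end
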